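import Summits.BirchSwinnertonDyer.BirchSwinnertonDyer.Theorems.ErratumRoadFiveEulerHalfNotRamSplitTwinTwo
import HarnessLib

/-!
# Route `ErratumRoadFive`, crux `EulerHalfNotRamNoInertSetAtFive` (item stmt-BirchSwinnertonDyer-19715), registered
# stub `stub_res_otherMultAtFive` ∕ the line's road stub `stub_splitSetRoadAtFive` (v2b): class-level corollaries of the core of
# record `missingUpperBoundAt_of_classX11b_of_not_ram_of_splitTwin₂` (`ErratumRoadFiveEulerHalfNotRamSplitTwinTwo.lean`, same seat)

Cell `bsd-stepL`, seat `bsd-line-er5-p1-w2` (D-0154 width seat -w2 on crux 19715, lead `bsd-line-er5-p1`),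
`--supports stmt-BirchSwinnertonDyer-19715`. THEOREMS ONLY (no definition, no named fact, no `sorry`). Mechanism and HONEST FRAMING:
the module docstrings of `…SplitTwin.lean` (p607137) ∕ `…SplitTwinTwo.lean` (`p ∣ N⁺` split in the Friedberg–Hoffstein field, the
offending primes in `N⁻`, (DEG) by a witness `ℓ₀ ≠ p`, by the witness `p` with a second prime outside, or by the FULL Papikian–Rabinoff
pairing — `2` allowed in the half —, the twist's half from crux `X11aLowerHalf`). The displayed binder `hHK` (split-`p` order-bound
display, corner-p1 g13's shape) is kept displayed here; `…SplitTwinOfItems.lean` feeds it from route items.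

A SPLIT-SET DATUM at `(E, p)` (the lead's v2b wording, with this seat's (W2) clause added): an even set `S ∌ p` of multiplicative primes
with no offending split prime off `S` (at `p`: non-split or `p ∤ ord_pΔ_min`) and a (DEG) datum — (W) a multiplicative `ℓ₀ ≠ p` with
`p ∤ ord_{ℓ₀}Δ_min`, or (W2) `p ∤ ord_pΔ_min` and a further multiplicative `t ∉ S`, `t ≠ p`, or (P₂) a half-size `R ⊆ S` of primes `q`
with `p ∤ q − 1` (`q = 2` allowed). Spelled out inline; no definition is introduced.

* `eulerHalfNotRam_of_splitTwinDatum` — every X11b ∧ `p ≥ 5` ∧ ¬(ram) pair with a split-set datum has the Euler-system half, from seven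
  PUBLISHED facts + `hHK` + the X11a lower half.
* `missingUpperBoundAt_of_classX11b_of_not_ram_of_twoOffending` — the three-prime shape of the crux's census (`S = {q₁, q₂}`, `R = {q₁}`,
  `p ∤ q₁ − 1`): 69 of the 70 R1b pairs below `5·10⁵` (kit j254667 rows re-read by this seat and, independently, by the lead and by referee
  g70; mirror `HOME/line-er5-p1/w2/r1b_splittwin_census.txt`); the pair left is `129360cy1@5` (`5` split, `ord₅Δ_min = 5`: the loss at the
  split place `p ∈ N⁺`).
* `stub_res_otherMultAtFive_of_splitTwin_of_residual` — the registered (v1) stub S2 VERBATIM, modulo ONE residual binder (the stub's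
  hypotheses + «no split-set datum»), i.e. S2 ⟸ road + the lead's v2b piece S2b up to the (W2) clause.

HONEST FRAMING: CONDITIONAL on every binder (`hHK` = the Kolyvagin ORDER bound on `X_{N⁺,N⁻}` at `p ∣ N⁺` in display form — item 19627 ∕
the cell's `casselsTate_levelInputs` + HELD split primitives; `X11aLowerHalf` = open crux 19064); nothing booked; no census label moves (T7);
neither stub nor crux is closed here; BSD is not proved for any curve by any of this.
-/

noncomputable section

open scoped Classical

open WeierstrassCurve NumberField IsDedekindDomain Literature.NumberTheory.EllipticCurves
  Rat.HeightOneSpectrum CongruenceSubgroup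
  Literature.NumberTheory.EllipticCurves.ModularForms
  Literature.NumberTheory.EllipticCurves.Rank1Residual
  Literature.NumberTheory.EllipticCurves.Rank1Residual.Typed
  Literature.NumberTheory.EllipticCurves.Wuthrich2014
  Literature.NumberTheory.EllipticCurves.BalakrishnanEtAl2019
  Literature.NumberTheory.QuadraticFields.Quadratic
  Literature.NumberTheory.Automorphic
  Summit.BirchSwinnertonDyer.Rank1Residual
  Summit.BirchSwinnertonDyer.Rank1Residual.X11b

-- the cell's Theorems namespace repeats the summit name (Summit.<Summit>.<Problem>), as in every sibling file
set_option linter.dupNamespace false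

namespace Summit.BirchSwinnertonDyer.BirchSwinnertonDyer.Theorems

/-! ### Every ¬(ram) pair carrying a SPLIT-SET DATUM; the three-prime pairs; the v1 stub S2 modulo its residue -/

/-- **The Euler-system half on X11b ∧ `p ≥ 5` ∧ ¬(ram) at every pair admitting a SPLIT-SET DATUM** ((W) ∨ (W2) ∨ (P₂), see the module
docstring) — from the published facts, the split-`p` order-bound display `hHK` and the X11a lower half. The class-level form of
`missingUpperBoundAt_of_classX11b_of_not_ram_of_splitTwin₂`; `ρ̄` onto and `p ∣ ∏c` are not needed. CONDITIONAL on the binders; nothing booked.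
[cite: JetchevSkinnerWan2017, §7.4.2 (pp. 30–31) and Thm. 4.4.1 (p. 19)] [cite: PastenShimura2024, Lemmas 6.15, 6.16 and 6.18 (arXiv v4 pp. 31–33)]
[cite: PapikianRabinoff2016, Cor. 3.5] [cite: Miller2011LMS, Def. 1.1] -/
theorem eulerHalfNotRam_of_splitTwinDatum
    (hGZK : rank_eq_analyticRank_of_analyticRank_le_one) (hmod : hasEntireLFunction_rat)
    (hnf : exists_isNewformOf)
    (hFH : friedbergHoffstein_exists_twist_ne_zero_inertAt)
    (hMaz : mazur_not_dvd_maninConstant_of_odd)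
    (hJL : nonempty_shimuraParametrizationData)
    (hCO : PastenShimura2024_componentOrders)
    (hHK :
        ∀ (V : WeierstrassCurve ℚ) [V.IsElliptic] [V.IsGloballyMinimal] (p : ℕ) [Fact p.Prime],
          5 ≤ p → Mult V p → Irr V p →
        ∀ (N : ℕ) [NeZero N] (K : Type) [Field K] [NumberField K] (S : Finset ℕ)
          (Dt : ModularParametrizationData V N)
          (X : ShimuraCurveData (∏ q ∈ S, q) (N / ∏ q ∈ S, q))
          (W' : WeierstrassCurve ℚ) [W'.IsElliptic] (P₀ : ShimuraParametrizationData X W'),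
          V.conductorNorm ℤ = N → IsImaginaryQuadratic K → Even S.card →
          (∀ ℓ ∈ S, ℓ.Prime ∧ ℓ ∣ N ∧ ¬ ℓ ^ 2 ∣ N ∧
            ((Ideal.span {(ℓ : ℤ)}).primesOver (𝓞 K)).ncard = 1 ∧ ¬ (ℓ : ℤ) ∣ NumberField.discr K) →
          (∀ ℓ : ℕ, ℓ.Prime → ℓ ∣ N → ℓ ∉ S → ((Ideal.span {(ℓ : ℤ)}).primesOver (𝓞 K)).ncard = 2) →
          ((Ideal.span {(p : ℤ)}).primesOver (𝓞 K)).ncard = 2 → P₀.IsMinimalFor V →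
          ∃ (P : (V.baseChange K).toAffine.Point) (degS : ℕ), 0 < degS ∧
            padicValNat p degS = padicValNat p P₀.deg ∧
            LDerivEK V K =
              8 * (Real.pi : ℂ) ^ 2 * peterssonProduct (Gamma0 N) 2 Dt.f Dt.f /
                  ((((Units.torsionOrder K : ℝ) / 2) ^ 2 * √|(NumberField.discr K : ℝ)| : ℝ) : ℂ) *
                ((P.canonicalHeight : ℂ) / (degS : ℂ)) ∧
            (¬ IsOfFinAddOrder P →
              Nat.card (AddCommGroup.primaryComponent (V.baseChange K).sha p) ≤
                p ^ (2 * padicValNat p (AddSubgroup.zmultiples P).index)))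
    -- (T3) the main-conjecture half on the rank-0 sister class X11a (crux `X11aLowerHalf`, all `p`)
    (hX11a : ∀ (Wd : WeierstrassCurve ℚ) [Wd.IsElliptic] [Wd.IsGloballyMinimal] (p : ℕ) [Fact p.Prime],
      ClassX11a Wd p → Typed.MissingLowerBoundAt Wd p) :
    ∀ (W : WeierstrassCurve ℚ) [W.IsElliptic] [W.IsGloballyMinimal] (p : ℕ) [Fact p.Prime],
      ClassX11b W p → 5 ≤ p → ¬ Ram W p →
        (∃ S : Finset ℕ, (∀ ℓ ∈ S, ∃ _ : Fact ℓ.Prime, Mult W ℓ) ∧ Even S.card ∧ p ∉ S ∧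
          (∀ (ℓ : ℕ) [Fact ℓ.Prime], ℓ ∉ S → W.HasSplitMultiplicativeReductionAtPrime ℓ →
            ¬ p ∣ padicValInt ℓ W.minimalDiscriminantInt) ∧
          ((∃ (ℓ₀ : ℕ) (_ : Fact ℓ₀.Prime), Mult W ℓ₀ ∧ ℓ₀ ≠ p ∧ ¬ p ∣ padicValInt ℓ₀ W.minimalDiscriminantInt) ∨
            (¬ p ∣ padicValInt p W.minimalDiscriminantInt ∧
              ∃ t : ℕ, ∃ _ : Fact t.Prime, t ≠ p ∧ t ∉ S ∧ Mult W t) ∨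
            ∃ R ⊆ S, S.card = 2 * R.card ∧ ∀ q ∈ R, ¬ p ∣ q - 1)) →
          Typed.MissingUpperBoundAt W p := by
  intro W _ _ p _ hX hp5 hnram hstd
  obtain ⟨S, hSmult, hSeven, hpS, hFC, hdeg⟩ := hstd
  exact missingUpperBoundAt_of_classX11b_of_not_ram_of_splitTwin₂ hGZK hmod hnf hFH hMaz hJL hCO hHK W p hX
    hp5 hnram (fun Wd _ _ hXd ↦ hX11a Wd p hXd) S hSmult hSeven hpS (fun ℓ _ hℓ hs ↦ hFC ℓ hℓ hs) hdeg

/-- **The three-prime pairs of crux 19715's census (R1b: `Mult(E) ⊇ {p, q₁, q₂}`, both `q_i` split offending)** — the split-set datum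
instantiated at `S = {q₁, q₂}` with the Papikian–Rabinoff half `R = {q₁}`: for an X11b ∧ `p ≥ 5` ∧ ¬(ram) pair with two distinct
multiplicative primes `q₁, q₂ ≠ p`, NO offending split prime off `{q₁, q₂}` (at `p`: non-split or `p ∤ ord_pΔ_min`), and `p ∤ q₁ − 1`
(so `q₁ = 2` qualifies), the Euler-system half holds from the published facts, `hHK` and the X11a lower half at `p`. Census: 69 of the 70 R1b
pairs below `5·10⁵` have this shape (`p = 5`: 59, `7`: 9, `11`: 1; e.g. the BC5 rung 8085y1@5 with `S = {3, 11}`, `R = {3}`; `19170s1@5` with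
`S = {2, 71}`, `R = {2}`); the pair left is `129360cy1@5` (`5` split, `ord₅Δ_min = 5`: `hFC` fails at `ℓ = p`). CONDITIONAL on the binders;
nothing booked. [cite: PastenShimura2024, Lemma 6.18 (arXiv v4 p. 33)] [cite: PapikianRabinoff2016, Cor. 3.5]
[cite: JetchevSkinnerWan2017, Thm. 4.4.1 (p. 19)] [cite: Miller2011LMS, Def. 1.1] -/
theorem missingUpperBoundAt_of_classX11b_of_not_ram_of_twoOffending
    (hGZK : rank_eq_analyticRank_of_analyticRank_le_one) (hmod : hasEntireLFunction_rat)
    (hnf : exists_isNewformOf)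
    (hFH : friedbergHoffstein_exists_twist_ne_zero_inertAt)
    (hMaz : mazur_not_dvd_maninConstant_of_odd)
    (hJL : nonempty_shimuraParametrizationData)
    (hCO : PastenShimura2024_componentOrders)
    (hHK :
        ∀ (V : WeierstrassCurve ℚ) [V.IsElliptic] [V.IsGloballyMinimal] (p : ℕ) [Fact p.Prime],
          5 ≤ p → Mult V p → Irr V p →
        ∀ (N : ℕ) [NeZero N] (K : Type) [Field K] [NumberField K] (S : Finset ℕ)
          (Dt : ModularParametrizationData V N)
          (X : ShimuraCurveData (∏ q ∈ S, q) (N / ∏ q ∈ S, q))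
          (W' : WeierstrassCurve ℚ) [W'.IsElliptic] (P₀ : ShimuraParametrizationData X W'),
          V.conductorNorm ℤ = N → IsImaginaryQuadratic K → Even S.card →
          (∀ ℓ ∈ S, ℓ.Prime ∧ ℓ ∣ N ∧ ¬ ℓ ^ 2 ∣ N ∧
            ((Ideal.span {(ℓ : ℤ)}).primesOver (𝓞 K)).ncard = 1 ∧ ¬ (ℓ : ℤ) ∣ NumberField.discr K) →
          (∀ ℓ : ℕ, ℓ.Prime → ℓ ∣ N → ℓ ∉ S → ((Ideal.span {(ℓ : ℤ)}).primesOver (𝓞 K)).ncard = 2) →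
          ((Ideal.span {(p : ℤ)}).primesOver (𝓞 K)).ncard = 2 → P₀.IsMinimalFor V →
          ∃ (P : (V.baseChange K).toAffine.Point) (degS : ℕ), 0 < degS ∧
            padicValNat p degS = padicValNat p P₀.deg ∧
            LDerivEK V K =
              8 * (Real.pi : ℂ) ^ 2 * peterssonProduct (Gamma0 N) 2 Dt.f Dt.f /
                  ((((Units.torsionOrder K : ℝ) / 2) ^ 2 * √|(NumberField.discr K : ℝ)| : ℝ) : ℂ) *
                ((P.canonicalHeight : ℂ) / (degS : ℂ)) ∧
            (¬ IsOfFinAddOrder P →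
              Nat.card (AddCommGroup.primaryComponent (V.baseChange K).sha p) ≤
                p ^ (2 * padicValNat p (AddSubgroup.zmultiples P).index)))
    (W : WeierstrassCurve ℚ) [W.IsElliptic] [W.IsGloballyMinimal] (p : ℕ) [Fact p.Prime]
    (hX : ClassX11b W p) (hp5 : 5 ≤ p) (hnram : ¬ Ram W p)
    (hX11a : ∀ (Wd : WeierstrassCurve ℚ) [Wd.IsElliptic] [Wd.IsGloballyMinimal],
      ClassX11a Wd p → Typed.MissingLowerBoundAt Wd p)
    -- the two inert primes `q₁ ≠ q₂`, multiplicative, `≠ p`; no offending split prime elsewhere (incl. at `p`)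
    {q₁ q₂ : ℕ} [Fact q₁.Prime] [Fact q₂.Prime] (hq : q₁ ≠ q₂) (hq₁p : q₁ ≠ p) (hq₂p : q₂ ≠ p)
    (hm₁ : Mult W q₁) (hm₂ : Mult W q₂)
    (hFC : ∀ (ℓ : ℕ) [Fact ℓ.Prime], ℓ ≠ q₁ → ℓ ≠ q₂ → W.HasSplitMultiplicativeReductionAtPrime ℓ →
      ¬ p ∣ padicValInt ℓ W.minimalDiscriminantInt)
    -- the Papikian–Rabinoff half: `p ∤ q₁ − 1` (e.g. `q₁ = 2`)
    (hq₁ : ¬ p ∣ q₁ - 1) :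
    Typed.MissingUpperBoundAt W p := by
  refine missingUpperBoundAt_of_classX11b_of_not_ram_of_splitTwin₂ hGZK hmod hnf hFH hMaz hJL hCO hHK W p hX hp5
    hnram hX11a {q₁, q₂} ?_ ?_ ?_ ?_ (Or.inr (Or.inr ⟨{q₁}, ?_, ?_, ?_⟩))
  · intro ℓ hℓ
    rcases Finset.mem_insert.mp hℓ with rfl | hℓ
    · exact ⟨inferInstance, hm₁⟩
    · rw [Finset.mem_singleton] at hℓ
      subst hℓ
      exact ⟨inferInstance, hm₂⟩
  · rw [Finset.card_pair hq]; exact ⟨1, rfl⟩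
  · intro h
    rcases Finset.mem_insert.mp h with h | h
    · exact hq₁p h.symm
    · exact hq₂p (Finset.mem_singleton.mp h).symm
  · intro ℓ _ hℓ hs
    have h₁ : ℓ ≠ q₁ := fun h ↦ hℓ (h ▸ Finset.mem_insert_self _ _)
    have h₂ : ℓ ≠ q₂ := fun h ↦ hℓ (h ▸ Finset.mem_insert_of_mem (Finset.mem_singleton_self _))
    exact hFC ℓ h₁ h₂ hs
  · exact Finset.singleton_subset_iff.mpr (Finset.mem_insert_self _ _)
  · rw [Finset.card_pair hq, Finset.card_singleton]
  · intro q hq'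
    rw [Finset.mem_singleton] at hq'
    subst hq'
    exact hq₁

/-- **Registered (v1) stub S2 `stub_res_otherMultAtFive` of crux 19715 (line `Lines/birth.lean`, plan g26) MODULO ITS SPLIT-SET RESIDUE —
the stub's signature VERBATIM as conclusion.** Inputs: the seven published facts, `hHK`, the X11a lower half (all `p`), and ONE residual
binder `hRes`: the stub's own hypotheses PLUS «no split-set datum» ⟹ the Euler half (the lead's v2b piece S2b, up to the extra (W2)
clause in the negated datum). On a pair with a split-set datum the conclusion is `eulerHalfNotRam_of_splitTwinDatum`; otherwise it is `hRes`
verbatim. Census: the residue holds 1 of the stub's 70 pairs below `5·10⁵` (`129360cy1@5`: `p` split with `p ∣ ord_pΔ_min` and two offending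
primes — the Tamagawa loss at the split place `p ∈ N⁺`, whose Jetchev-type removal on `X_{N⁺,N⁻}` is not in print; `{p} ∪ O` is odd, so `p`
cannot go to `N⁻` either). CONDITIONAL; the stub is NOT closed (`--supports`, helper); nothing booked.
[cite: JetchevSkinnerWan2017, §7.4.2 and Thm. 4.4.1] [cite: PastenShimura2024, Lemmas 6.15, 6.16 and 6.18] [cite: PapikianRabinoff2016, Cor. 3.5]
[cite: Miller2011LMS, Def. 1.1] -/
theorem stub_res_otherMultAtFive_of_splitTwin_of_residual
    (hGZK : rank_eq_analyticRank_of_analyticRank_le_one) (hmod : hasEntireLFunction_rat)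
    (hnf : exists_isNewformOf)
    (hFH : friedbergHoffstein_exists_twist_ne_zero_inertAt)
    (hMaz : mazur_not_dvd_maninConstant_of_odd)
    (hJL : nonempty_shimuraParametrizationData)
    (hCO : PastenShimura2024_componentOrders)
    (hHK :
        ∀ (V : WeierstrassCurve ℚ) [V.IsElliptic] [V.IsGloballyMinimal] (p : ℕ) [Fact p.Prime],
          5 ≤ p → Mult V p → Irr V p →
        ∀ (N : ℕ) [NeZero N] (K : Type) [Field K] [NumberField K] (S : Finset ℕ)
          (Dt : ModularParametrizationData V N)
          (X : ShimuraCurveData (∏ q ∈ S, q) (N / ∏ q ∈ S, q))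
          (W' : WeierstrassCurve ℚ) [W'.IsElliptic] (P₀ : ShimuraParametrizationData X W'),
          V.conductorNorm ℤ = N → IsImaginaryQuadratic K → Even S.card →
          (∀ ℓ ∈ S, ℓ.Prime ∧ ℓ ∣ N ∧ ¬ ℓ ^ 2 ∣ N ∧
            ((Ideal.span {(ℓ : ℤ)}).primesOver (𝓞 K)).ncard = 1 ∧ ¬ (ℓ : ℤ) ∣ NumberField.discr K) →
          (∀ ℓ : ℕ, ℓ.Prime → ℓ ∣ N → ℓ ∉ S → ((Ideal.span {(ℓ : ℤ)}).primesOver (𝓞 K)).ncard = 2) →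
          ((Ideal.span {(p : ℤ)}).primesOver (𝓞 K)).ncard = 2 → P₀.IsMinimalFor V →
          ∃ (P : (V.baseChange K).toAffine.Point) (degS : ℕ), 0 < degS ∧
            padicValNat p degS = padicValNat p P₀.deg ∧
            LDerivEK V K =
              8 * (Real.pi : ℂ) ^ 2 * peterssonProduct (Gamma0 N) 2 Dt.f Dt.f /
                  ((((Units.torsionOrder K : ℝ) / 2) ^ 2 * √|(NumberField.discr K : ℝ)| : ℝ) : ℂ) *
                ((P.canonicalHeight : ℂ) / (degS : ℂ)) ∧
            (¬ IsOfFinAddOrder P →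
              Nat.card (AddCommGroup.primaryComponent (V.baseChange K).sha p) ≤
                p ^ (2 * padicValNat p (AddSubgroup.zmultiples P).index)))
    (hX11a : ∀ (Wd : WeierstrassCurve ℚ) [Wd.IsElliptic] [Wd.IsGloballyMinimal] (p : ℕ) [Fact p.Prime],
      ClassX11a Wd p → Typed.MissingLowerBoundAt Wd p)
    -- the RESIDUE of the stub: its own hypotheses and NO split-set datum
    (hRes : ∀ (W : WeierstrassCurve ℚ) [W.IsElliptic] [W.IsGloballyMinimal] (p : ℕ) [Fact p.Prime],
      ClassX11b W p → 5 ≤ p → Surj W p → ¬ Ram W p → p ∣ W.tamagawaProduct →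
        (∃ ℓ : ℕ, ∃ _ : Fact ℓ.Prime, ℓ ≠ p ∧ W.HasMultiplicativeReductionAtPrime ℓ) →
        ¬ (∃ S : Finset ℕ, (∀ ℓ ∈ S, ∃ _ : Fact ℓ.Prime, Mult W ℓ) ∧ Even S.card ∧ p ∈ S ∧
          (∀ (ℓ : ℕ) [Fact ℓ.Prime], ℓ ∉ S → W.HasSplitMultiplicativeReductionAtPrime ℓ →
            ¬ p ∣ padicValInt ℓ W.minimalDiscriminantInt) ∧
          (¬ p ∣ padicValInt p W.minimalDiscriminantInt ∨
            ∃ R ⊆ S, S.card = 2 * R.card ∧ ∀ q ∈ R, q ≠ 2 ∧ ¬ p ∣ q - 1)) →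
        ¬ (∃ S : Finset ℕ, (∀ ℓ ∈ S, ∃ _ : Fact ℓ.Prime, Mult W ℓ) ∧ Even S.card ∧ p ∉ S ∧
          (∀ (ℓ : ℕ) [Fact ℓ.Prime], ℓ ∉ S → W.HasSplitMultiplicativeReductionAtPrime ℓ →
            ¬ p ∣ padicValInt ℓ W.minimalDiscriminantInt) ∧
          ((∃ (ℓ₀ : ℕ) (_ : Fact ℓ₀.Prime), Mult W ℓ₀ ∧ ℓ₀ ≠ p ∧ ¬ p ∣ padicValInt ℓ₀ W.minimalDiscriminantInt) ∨
            (¬ p ∣ padicValInt p W.minimalDiscriminantInt ∧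
              ∃ t : ℕ, ∃ _ : Fact t.Prime, t ≠ p ∧ t ∉ S ∧ Mult W t) ∨
            ∃ R ⊆ S, S.card = 2 * R.card ∧ ∀ q ∈ R, ¬ p ∣ q - 1)) →
          Typed.MissingUpperBoundAt W p) :
    ∀ (W : WeierstrassCurve ℚ) [W.IsElliptic] [W.IsGloballyMinimal] (p : ℕ) [Fact p.Prime],
      ClassX11b W p → 5 ≤ p → Surj W p → ¬ Ram W p → p ∣ W.tamagawaProduct →
        (∃ ℓ : ℕ, ∃ _ : Fact ℓ.Prime, ℓ ≠ p ∧ W.HasMultiplicativeReductionAtPrime ℓ) →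
        ¬ (∃ S : Finset ℕ, (∀ ℓ ∈ S, ∃ _ : Fact ℓ.Prime, Mult W ℓ) ∧ Even S.card ∧ p ∈ S ∧
          (∀ (ℓ : ℕ) [Fact ℓ.Prime], ℓ ∉ S → W.HasSplitMultiplicativeReductionAtPrime ℓ →
            ¬ p ∣ padicValInt ℓ W.minimalDiscriminantInt) ∧
          (¬ p ∣ padicValInt p W.minimalDiscriminantInt ∨
            ∃ R ⊆ S, S.card = 2 * R.card ∧ ∀ q ∈ R, q ≠ 2 ∧ ¬ p ∣ q - 1)) →
          Typed.MissingUpperBoundAt W p := by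
  intro W _ _ p _ hX hp5 hsurj hnram htam hm hno
  by_cases hstd : (∃ S : Finset ℕ, (∀ ℓ ∈ S, ∃ _ : Fact ℓ.Prime, Mult W ℓ) ∧ Even S.card ∧ p ∉ S ∧
      (∀ (ℓ : ℕ) [Fact ℓ.Prime], ℓ ∉ S → W.HasSplitMultiplicativeReductionAtPrime ℓ →
        ¬ p ∣ padicValInt ℓ W.minimalDiscriminantInt) ∧
      ((∃ (ℓ₀ : ℕ) (_ : Fact ℓ₀.Prime), Mult W ℓ₀ ∧ ℓ₀ ≠ p ∧ ¬ p ∣ padicValInt ℓ₀ W.minimalDiscriminantInt) ∨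
        (¬ p ∣ padicValInt p W.minimalDiscriminantInt ∧
          ∃ t : ℕ, ∃ _ : Fact t.Prime, t ≠ p ∧ t ∉ S ∧ Mult W t) ∨
        ∃ R ⊆ S, S.card = 2 * R.card ∧ ∀ q ∈ R, ¬ p ∣ q - 1))
  · exact eulerHalfNotRam_of_splitTwinDatum hGZK hmod hnf hFH hMaz hJL hCO hHK hX11a W p hX hp5 hnram hstd
  · exact hRes W p hX hp5 hsurj hnram htam hm hno hstd

end Summit.BirchSwinnertonDyer.BirchSwinnertonDyer.Theorems

end
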